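import Literature.Computability.Cryptography.BlumMicaliMachine2
import Literature.Computability.Complexity.StackUnary
import HarnessLib

/-!
# The Blum–Micali reduction on a stack machine, III: parameters, parsing, and polynomial time

The last part of the machine begun in `BlumMicaliMachine.lean` / `BlumMicaliMachine2.lean`.

* The parameter phase (`paramsProg`, `runs_params`): from the parsed `p, g, y` the constants bank
  `mkC Q p g y` — `1, 2, p - 1, h, g⁻¹, g^h, ℓ = |p|`, then `q = Q(ℓ)` by Horner's rule over the
  coefficient list highest first (`hornerS`, `runs_hornerS`; the arithmetic is `Com.hornerVal` /
  `Com.coeffsHL` of `StackUnary.lean`), `m, k, S` (guarding `q = 0`) and the unary counters, the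
  `2`-adic splitting `p - 1 = 2^s t` by a counted loop (`stripBodyS`, `runs_stripBody`, using
  `stripStep_iterate_eq` of part I), `(t+1)/2`, `z⁻¹`; `(10900 + 342 (deg Q + 1)) (N+1)⁴` steps.
* Parsing (`parseS`, `runs_parseS`: the machine input `⟨z, ⟨u, s⟩⟩` into the raw answer strings of
  `StackOracle.lean`, the coins, and the numerals of `p, g, y`), the guard `bmGuard` into a flag
  (`guardS`, `runs_guardS`), the size bound from the guard (`bnd_of_guard`: `Bnd Q p g y (bmN Q n)`
  with `bmN Q n = 48 (n+1)(Q(n)+1)² + 6n + 2Q(n) + 12`), and the guarded main part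
  (`impl_main`: behind the guard the parameters and the body, else the empty output at once).
* The whole machine `bmMachine Q` and its string function `bmF Q` (the tagged raw replay of
  `bmComp Q`): `bmMachine_spec` (runs, or halts at a query, within `bmTime Q` steps with the
  right output), hence `bmF Q ∈ FP` (`Com.mem_FP`) and, re-indexing along the input pairing
  (`PolyTimeComputable.of_encode`, `OracleComp.toStep_eq_feedRaw`), the discharge
  `bmOracleAlg_isPolyTime_holds` of the named fact of `BlumMicaliAlgorithm.lean`. The discharge of
  Blum–Micali's Theorem 3 itself (`blumMicali_halfPredicate_dlog_holds`) is the one-line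
  consequence recorded in `BlumMicaliProofs.lean`.

## References

* M. Blum, S. Micali, *How to generate cryptographically strong sequences of pseudo-random bits*,
  SIAM J. Comput. 13 (1984) 850–864, §3.3, Theorem 3 and its proof ("the following probabilistic
  poly(|p|) time algorithm").
* E. Kranakis, *Primality and Cryptography*, Wiley–Teubner 1986, Thm. 1.15 (Step 1: `p - 1 = 2^e P`).
* D. E. Knuth, *The Art of Computer Programming*, Vol. 2, 3rd ed., 1998, §4.6.4 (Horner's rule).
  (Not held; standard.)
* A. Cobham, *The intrinsic computational difficulty of functions*, 1965 (closure of polynomial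
  time under the schemes used). (Not held; standard.)
-/

namespace Literature.Computability.Cryptography
namespace BMMachine

open _root_.Computability Complexity Complexity.Com

attribute [local simp] not_or_self_iff'

/-! ### The parameter phase -/

section Params

variable {Q : Polynomial ℕ} {p g y N : ℕ}

/-- All constants zero (the constants bank empty). [folklore] -/
def zeroC : Consts :=
  { p := 0, g := 0, y := 0, gi := 0, h := 0, gh := 0, pm := 0, one := 0, two := 0, q := 0, m := 0, mu := 0, k := 0,
    ku := 0, s := 0, l := 0, lu := 0, od := 0, exh := 0, zi := 0, csu := 0, pw2 := 0 }

/-- The empty constants bank. [folklore] -/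
@[simp] theorem encC_zeroC (r : BC) : encC zeroC r = [] := by cases r <;> rfl

/-- The constants after parsing: only `p`, `g`, `y`. [folklore] -/
def cParsed (p g y : ℕ) : Consts := { zeroC with p := p, g := g, y := y }

/-- The constants after the first parameter script: `1`, `2`, `p - 1`, `h`, `g⁻¹`, `g^h`, `ℓ`.
[folklore] -/
def cPar1 (p g y : ℕ) : Consts :=
  { cParsed p g y with one := 1, two := 2, pm := p - 1, h := (p - 1) / 2, gi := g ^ (p - 2) % p,
                       gh := g ^ ((p - 1) / 2) % p, l := p.size, lu := p.size }

/-- The constants after the second parameter script: `q`, `m`, `k`, `S`, and the start of the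
`2`-adic splitting (`OD := p - 1`, `PW2 := 1`). [folklore] -/
def cPar2 (Q : Polynomial ℕ) (p g y : ℕ) : Consts :=
  { cPar1 p g y with q := bmQ Q p, m := bmM Q p, mu := bmM Q p, k := bmK Q p, ku := bmK Q p, s := bmSeg Q p,
                     od := p - 1, pw2 := 1 }

/-- The constants during the splitting loop, after `j` halvings attempted. [folklore] -/
def cStrip (Q : Polynomial ℕ) (p g y : ℕ) (j : ℕ) : Consts :=
  { cPar2 Q p g y with od := (stripStep^[j] (p - 1, 0)).1, csu := (stripStep^[j] (p - 1, 0)).2,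
                       pw2 := 2 ^ (stripStep^[j] (p - 1, 0)).2 }

open NS NOp in
/-- First parameter script. [folklore] -/
def par1S : NS O :=
  ofList [.const (cc .ONE) (encodeNat 1), .const (cc .TWO) (encodeNat 2), .sub (cc .PM) (cc .P) (cc .ONE),
    .divMod (cc .H) (vv .T1) (cc .PM) (cc .TWO), .clear (vv .T1), .sub (vv .T1) (cc .P) (cc .TWO),
    .powMod (cc .GI) (cc .G) (vv .T1) (cc .P), .clear (vv .T1), .powMod (cc .GH) (cc .G) (cc .H) (cc .P),
    .len (cc .L) (cc .P) (vv .LT), .toUnary (cc .LU) (cc .L)]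

open NS NOp in
/-- Horner evaluation of `Q` at `ℓ` into register `Q`, over the coefficients highest first:
`Q := Q · L + c` per coefficient. [Knuth 1998, §4.6.4; `Com.hornerVal` of `StackUnary.lean`] [folklore] -/
def hornerS : List ℕ → NS O
  | [] => nop
  | c :: cs => (ofList [.mul (cc .Q) (cc .Q) (cc .L), .const (vv .T1) (encodeNat c), .add (cc .Q) (cc .Q) (vv .T1),
      .clear (vv .T1)]).seq (hornerS cs)

open NS NOp in
/-- Second parameter script: `m = 12 ℓ q²`, `k = ℓ + |q+1|`, `S = ⌊(p-1)/2q⌋ + 1` (guarding `q = 0`),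
the unary counters, and the start of the splitting loop. [folklore] -/
def par2S : NS O :=
  (ofList [.const (vv .T1) (encodeNat 12), .mul (cc .M) (vv .T1) (cc .L), .mul (vv .T2) (cc .Q) (cc .Q),
    .mul (cc .M) (cc .M) (vv .T2), .clear (vv .T1), .clear (vv .T2), .toUnary (cc .MU) (cc .M),
    .succ (vv .T1) (cc .Q), .len (cc .K) (vv .T1) (vv .LT), .add (cc .K) (cc .K) (cc .L), .clear (vv .T1),
    .toUnary (cc .KU) (cc .K), .add (vv .T1) (cc .Q) (cc .Q), .cmp (vv .FQ) (vv .T1) (cc .ONE)]).seq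
  ((ite (vv .FQ) (ofList [.divMod (cc .S) (vv .T2) (cc .PM) (vv .T1), .clear (vv .T2)]) nop).seq
    (ofList [.succ (cc .S) (cc .S), .clear (vv .T1), .copy (cc .PM) (cc .OD), .const (cc .PW2) (encodeNat 1),
      .copy (cc .LU) (vv .CS)]))

open NS NOp in
/-- The body of the splitting loop: halve `OD` while even, counting in `CSU` (unary) and `PW2`.
[Kranakis 1986, Thm. 1.15, Step 1] [folklore] -/
def stripBodyS : NS O :=
  (ofList [.divMod (vv .T1) (vv .T2) (cc .OD) (cc .TWO), .not (vv .T2)]).seq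
    (ite (vv .T2) (ofList [.clear (cc .OD), .move (vv .T1) (cc .OD), .push (cc .CSU) true, .add (cc .PW2) (cc .PW2) (cc .PW2)])
      (op (.clear (vv .T1))))

open NS NOp in
/-- Third parameter script: `(t+1)/2` and `z⁻¹ = g^{p-1-t}`. [folklore] -/
def par3S : NS O :=
  ofList [.succ (vv .T1) (cc .OD), .divMod (cc .EXH) (vv .T2) (vv .T1) (cc .TWO), .clear (vv .T1), .clear (vv .T2),
    .sub (vv .T1) (cc .PM) (cc .OD), .powMod (cc .ZI) (cc .G) (vv .T1) (cc .P), .clear (vv .T1)]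

/-- **The parameter program.** [folklore] -/
noncomputable def paramsProg (Q : Polynomial ℕ) : Com (EReg ⊕ O) :=
  par1S.com ;; ((hornerS (coeffsHL Q)).com ;; (par2S.com ;; (loop (Sum.inr (vv .CS)) stripBodyS.com stripBodyS.com ;; par3S.com)))

/-- Effect of the first parameter script. [folklore] -/
theorem runs_par1 (hB : Bnd Q p g y N) (σ : List Bool × List Bool) (v : Vars) :
    Runs par1S.com (st σ (cParsed p g y) v) (st σ (cPar1 p g y) v) (4800 * (N + 1) ^ 3) := by
  have hp0 := hB.p_pos
  have hp1 := hB.one_lt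
  have h1N := hB.one_le_N
  have hlp := hB.len_p
  have hl := hB.l_le
  refine NS.runs_of_eq (N := N) par1S _ ?_ ?_ ?_
  · have hll : (encodeNat (encodeNat p).length).length ≤ N := len_of_le hlp
    have hm2 : (encodeNat ((p - 1) % 2)).length ≤ N := hB.len_lt (lt_of_lt_of_le (Nat.mod_lt _ two_pos) hB.two_le)
    simp [par1S, vv, cc, cParsed, zeroC, h1N, hlp, hp1, hB.len_le hB.two_le, hB.two_le, hB.len_le (Nat.sub_le p 1),
      hB.len_le (Nat.sub_le p 2), hB.len_lt hB.g_lt, hB.len_le hB.h_lt.le, hll, hm2]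
    omega
  · simp [par1S, vv, cc, cParsed, cPar1, zeroC, TM2Pass.length_encodeNat_eq_size]
    congr 1; funext r; rcases r with r | r
    · cases r <;> simp
    · cases r <;> simp
  · simp [par1S]

/-- **Horner evaluation on the machine**: `hornerS cs` takes `Q = A` to `Q = hornerVal ℓ A cs`
(`ℓ` the value of `L`), provided all partial values and coefficients are at most `B ≤ N`.
[Knuth 1998, §4.6.4] [folklore] -/
theorem runs_hornerS (hB : Bnd Q p g y N) (σ : List Bool × List Bool) (v : Vars) {B : ℕ} (hBN : B ≤ N) :
    ∀ (cs : List ℕ) (c : Consts), c.l = p.size → hornerVal p.size c.q cs ≤ B → (∀ a ∈ cs, a ≤ B) →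
      Runs (hornerS cs).com (st σ c v) (st σ { c with q := hornerVal p.size c.q cs } v) (cs.length * (342 * (N + 1) ^ 3))
  | [], c, _, _, _ => by
    have : { c with q := hornerVal p.size c.q [] } = c := by simp [hornerVal]
    rw [this]
    exact (Runs.skip _).mono (Nat.zero_le _)
  | a :: cs, c, hl, hv, hcs => by
    have hl1 : 1 ≤ p.size := Nat.size_pos.2 hB.p_pos
    have hA : c.q ≤ B := (le_hornerVal hl1 (a :: cs) c.q).trans hv
    have hA' : c.q * p.size + a ≤ B := by
      have := le_hornerVal hl1 cs (c.q * p.size + a)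
      rw [hornerVal, List.foldl_cons] at hv
      exact this.trans hv
    have ha : a ≤ B := hcs a (by simp)
    have hlq : (encodeNat c.q).length ≤ N := len_of_le (hA.trans hBN)
    have hlqx : (encodeNat (c.q * p.size)).length ≤ N := len_of_le ((Nat.le_add_right _ _).trans (hA'.trans hBN))
    have h1 : Runs (NS.ofList [.mul (cc .Q) (cc .Q) (cc .L), .const (vv .T1) (encodeNat a), .add (cc .Q) (cc .Q) (vv .T1),
        .clear (vv .T1)]).com (st σ c v) (st σ { c with q := c.q * p.size + a } v) (342 * (N + 1) ^ 3) := by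
      refine NS.runs_of_eq (N := N) _ _ ?_ ?_ ?_
      · simp [vv, cc, hl, hlq, len_of_le hB.l_le, len_of_le (ha.trans hBN), hlqx]
        omega
      · simp [vv, cc, hl]
        congr 1; funext r; rcases r with r | r
        · cases r <;> simp [hl]
        · cases r <;> simp
      · simp
    have h2 := runs_hornerS hB σ v hBN cs { c with q := c.q * p.size + a } hl
      (by rw [hornerVal, List.foldl_cons] at hv; exact hv) (fun a' ha' => hcs a' (by simp [ha']))
    refine (h1.seq h2).of_eq rfl (le_of_eq ?_)
    rw [List.length_cons]; ring

/-- `12 ℓ q²` in the order the machine multiplies. [folklore] -/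
theorem bmM_eq' (Q : Polynomial ℕ) (p : ℕ) : 12 * p.size * (bmQ Q p * bmQ Q p) = bmM Q p := by
  unfold bmM; ring

/-- Effect of the second parameter script. [folklore] -/
theorem runs_par2 (hB : Bnd Q p g y N) (σ : List Bool × List Bool) (v : Vars) :
    Runs par2S.com (st σ { cPar1 p g y with q := bmQ Q p } v)
      (qst σ (Function.update (encSt (cPar2 Q p g y) v) (Sum.inr .CS) (List.replicate p.size true))) (1715 * (N + 1) ^ 3) := by
  have hp0 := hB.p_pos
  have hp1 := hB.one_lt
  have h1N := hB.one_le_N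
  have hq := hB.q_le
  have hm := hB.m_le
  have hk := hB.k_le
  have hl := hB.l_le
  have h48 : 48 ≤ N := by
    refine le_trans ?_ hB.valM
    calc 48 = 48 * 1 * 1 := rfl
      _ ≤ 48 * (p.size + 1) * (bmQ Q p + 1) ^ 2 :=
        Nat.mul_le_mul (Nat.mul_le_mul_left 48 (by omega)) (Nat.one_le_pow _ _ (Nat.succ_pos _))
  have hq1 : bmQ Q p + 1 ≤ N := by
    refine le_trans ?_ hB.valM
    calc bmQ Q p + 1 ≤ (bmQ Q p + 1) ^ 2 := by rw [pow_two]; exact Nat.le_mul_of_pos_left _ (Nat.succ_pos _)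
      _ ≤ 48 * (p.size + 1) * (bmQ Q p + 1) ^ 2 := Nat.le_mul_of_pos_left _ (by positivity)
  have h12 : (encodeNat 12).length ≤ N := (length_encodeNat_le_self 12).trans (by omega)
  have hqq : (encodeNat (bmQ Q p * bmQ Q p)).length ≤ N := by
    refine (Brick.length_encodeNat_mono ?_).trans (len_of_le hm)
    unfold bmM; rw [pow_two]; have := Nat.size_pos.2 hp0; nlinarith
  have h12l : (encodeNat (12 * p.size)).length ≤ N := by
    refine len_of_le (le_trans ?_ hB.valM)
    calc 12 * p.size ≤ 48 * (p.size + 1) * 1 := by omega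
      _ ≤ 48 * (p.size + 1) * (bmQ Q p + 1) ^ 2 := Nat.mul_le_mul_left _ (Nat.one_le_pow _ _ (Nat.succ_pos _))
  have hS : bmSeg Q p ≤ p := by unfold bmSeg; have := Nat.div_le_self (p - 1) (2 * bmQ Q p); omega
  have hkdef : (encodeNat (bmQ Q p + 1)).length + p.size = bmK Q p := by
    unfold bmK; rw [TM2Pass.length_encodeNat_eq_size, add_comm]
  have hlk : (encodeNat (bmK Q p)).length ≤ N := len_of_le hk
  have hlq : (encodeNat (bmQ Q p)).length ≤ N := len_of_le hq
  have hlq1 : (encodeNat (bmQ Q p + 1)).length ≤ N := len_of_le hq1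
  have hlq1l : (encodeNat (encodeNat (bmQ Q p + 1)).length).length ≤ N :=
    len_of_le ((length_encodeNat_le_self _).trans hq1)
  have hlq1l1 : (encodeNat (encodeNat (bmQ Q p + 1)).length).length ≤ N + 1 := hlq1l.trans N.le_succ
  have h2q' : bmQ Q p + bmQ Q p ≤ N := by have := hB.two_q_le; omega
  have hl2q : (encodeNat (bmQ Q p + bmQ Q p)).length ≤ N := len_of_le h2q'
  have hlmod : (encodeNat ((p - 1) % (bmQ Q p + bmQ Q p))).length ≤ N :=
    hB.len_le ((Nat.mod_le _ _).trans (Nat.sub_le p 1))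
  have hldiv : (encodeNat ((p - 1) / (bmQ Q p + bmQ Q p))).length ≤ N :=
    hB.len_le ((Nat.div_le_self _ _).trans (Nat.sub_le p 1))
  have hldiv1 : (encodeNat ((p - 1) / (bmQ Q p + bmQ Q p))).length ≤ N + 1 := hldiv.trans N.le_succ
  by_cases hq0 : bmQ Q p = 0
  · refine NS.runs_of_eq (N := N) par2S _ ?_ ?_ ?_
    · have hk0 : 1 + p.size = bmK Q p := by rw [← hkdef, hq0]; rfl
      simp [par2S, vv, cc, cPar1, cParsed, zeroC, hq0, h1N, h12, hl, len_of_le hl,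
        hB.len_le (Nat.sub_le p 1), h12l, hk0, hk, hlk]
      omega
    · simp [par2S, vv, cc, cPar1, cPar2, cParsed, zeroC, hq0]
      congr 1; funext r; rcases r with r | r
      · cases r <;> simp [bmM, bmK, bmSeg, hq0, add_comm]
      · cases r <;> simp
    · simp [par2S]
  · have hdec : 1 ≤ bmQ Q p + bmQ Q p := by omega
    refine NS.runs_of_eq (N := N) par2S _ ?_ ?_ ?_
    · simp [par2S, vv, cc, cPar1, cParsed, zeroC, hdec, h1N, h12, hl, len_of_le hl, bmM_eq', len_of_le hm,
        hB.len_le (Nat.sub_le p 1), h12l, hqq, hlq, hlq1, hlq1l, hlq1l1, hkdef, hk, hlk, hl2q, hlmod, hldiv, hldiv1]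
      omega
    · simp [par2S, vv, cc, cPar1, cPar2, cParsed, zeroC, hdec, bmM_eq', TM2Pass.length_encodeNat_eq_size]
      congr 1; funext r; rcases r with r | r
      · cases r <;> simp [bmK, bmSeg, add_comm, two_mul]
      · cases r <;> simp
    · simp [par2S]

/-- The invariant of the splitting loop: `2^s · t = p - 1`. [Kranakis 1986, Thm. 1.15, Step 1] [folklore] -/
theorem stripStep_iterate_mul (x : ℕ) : ∀ j, 2 ^ (stripStep^[j] (x, 0)).2 * (stripStep^[j] (x, 0)).1 = x
  | 0 => by simp
  | j + 1 => by
    rw [Function.iterate_succ_apply']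
    have ih := stripStep_iterate_mul x j
    generalize stripStep^[j] (x, 0) = ts at ih ⊢
    obtain ⟨t, s⟩ := ts
    simp only [stripStep]
    split
    · rename_i h
      simp only at h ⊢
      rw [pow_succ, mul_assoc, Nat.mul_div_cancel' (Nat.dvd_of_mod_eq_zero h)]
      exact ih
    · exact ih

/-- **One round of the splitting loop.** [Kranakis 1986, Thm. 1.15, Step 1] [folklore] -/
theorem runs_stripBody (hB : Bnd Q p g y N) (σ : List Bool × List Bool) (v : Vars) (j : ℕ) (w : List Bool) :
    Runs stripBodyS.com (qst σ (Function.update (encSt (cStrip Q p g y j) v) (Sum.inr .CS) w))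
      (qst σ (Function.update (encSt (cStrip Q p g y (j + 1)) v) (Sum.inr .CS) w)) (445 * (N + 1) ^ 3) := by
  have hp1 := hB.one_lt
  have hinv := stripStep_iterate_mul (p - 1) j
  have hstep : stripStep^[j + 1] (p - 1, 0) = stripStep (stripStep^[j] (p - 1, 0)) := Function.iterate_succ_apply' _ _ _
  generalize hts : stripStep^[j] (p - 1, 0) = ts at hinv hstep
  obtain ⟨t, s⟩ := ts
  simp only at hinv
  have ht : t ≤ p - 1 := by
    calc t = 1 * t := (one_mul t).symm
      _ ≤ 2 ^ s * t := Nat.mul_le_mul_right _ (Nat.one_le_two_pow)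
      _ = p - 1 := hinv
  have h2s : 2 ^ s ≤ p - 1 := by
    rcases Nat.eq_zero_or_pos t with h0 | h0
    · subst h0; simp at hinv; omega
    · calc 2 ^ s = 2 ^ s * 1 := (mul_one _).symm
        _ ≤ 2 ^ s * t := Nat.mul_le_mul_left _ h0
        _ = p - 1 := hinv
  have hlt : (encodeNat t).length ≤ N := hB.len_le (ht.trans (Nat.sub_le p 1))
  have hl2 : (encodeNat 2).length ≤ N := hB.len_le hB.two_le
  have hlt2 : (encodeNat (t / 2)).length ≤ N := hB.len_le ((Nat.div_le_self _ _).trans (ht.trans (Nat.sub_le p 1)))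
  have hl2s : (encodeNat (2 ^ s)).length ≤ N := hB.len_le (h2s.trans (Nat.sub_le p 1))
  have hl2s1 : (encodeNat (2 ^ s)).length ≤ N + 1 := hl2s.trans N.le_succ
  have hmod2 : encodeNat (t % 2) = [] ∨ encodeNat (t % 2) = [true] := by
    rcases Nat.mod_two_eq_zero_or_one t with h | h <;> simp [h]
  by_cases he : t % 2 = 0
  · refine NS.runs_of_eq (N := N) stripBodyS _ ?_ ?_ ?_
    · simp [stripBodyS, vv, cc, cStrip, cPar2, cPar1, cParsed, zeroC, hts, hlt, hl2, he, hlt2, hl2s, hl2s1]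
    · simp [stripBodyS, vv, cc, cStrip, cPar2, cPar1, cParsed, zeroC, hts, hstep, stripStep, he]
      congr 1; funext r; rcases r with r | r
      · cases r <;> simp [List.replicate_succ, pow_succ, mul_two]
      · cases r <;> simp
    · simp [stripBodyS]
  · have he1 : t % 2 = 1 := by omega
    refine NS.runs_of_eq (N := N) stripBodyS _ ?_ ?_ ?_
    · simp [stripBodyS, vv, cc, cStrip, cPar2, cPar1, cParsed, zeroC, hts, hlt, hl2, he1, hlt2]
    · simp [stripBodyS, vv, cc, cStrip, cPar2, cPar1, cParsed, zeroC, hts, hstep, stripStep, he1]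
      congr 1; funext r; rcases r with r | r
      · cases r <;> simp
      · cases r <;> simp
    · simp [stripBodyS]

/-- Effect of the third parameter script, from the constants after the splitting loop. [folklore] -/
theorem runs_par3 (hB : Bnd Q p g y N) (σ : List Bool × List Bool) (v : Vars) :
    Runs par3S.com (st σ (cStrip Q p g y p.size) v) (st σ (mkC Q p g y) v) (2402 * (N + 1) ^ 3) := by
  have hp0 := hB.p_pos
  have hp1 := hB.one_lt
  have hst : stripStep^[p.size] (p - 1, 0) = (bmOddPart p, bmTwoExp p) := stripStep_iterate_eq hB.two_le hB.s_lt_l.le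
  have hod : bmOddPart p ≤ p - 1 := bmOddPart_le p
  have hl1 : (encodeNat (bmOddPart p)).length ≤ N := hB.len_le (hod.trans (Nat.sub_le p 1))
  have hl2 : (encodeNat (bmOddPart p + 1)).length ≤ N := hB.len_le (by omega)
  have hl4 : (encodeNat ((bmOddPart p + 1) % 2)).length ≤ N := hB.len_lt (lt_of_lt_of_le (Nat.mod_lt _ two_pos) hB.two_le)
  have hl5 : (encodeNat (p - 1 - bmOddPart p)).length ≤ N := hB.len_le (by omega)
  refine NS.runs_of_eq (N := N) par3S _ ?_ ?_ ?_
  · simp [par3S, vv, cc, cStrip, cPar2, cPar1, cParsed, zeroC, hst, hl1, hl2, hl4, hl5, hB.len_le hB.two_le,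
      hB.len_le (Nat.sub_le p 1), hod, hB.len_lt hB.g_lt, hB.len_p, hp1]
  · simp [par3S, vv, cc, cStrip, cPar2, cPar1, cParsed, zeroC, hst]
    congr 1; funext r; rcases r with r | r
    · cases r <;> simp [mkC]
    · cases r <;> simp
  · simp [par3S]

/-- **The parameter program computes the constants of the instance** (`mkC Q p g y`) from the
parsed `p, g, y`, in `(10900 + 342 (deg Q + 1)) (N+1)⁴` steps. [Blum–Micali 1984, §3.3, proof of
Theorem 3 (the parameters `n = 2Q(|p|)`, `trials`, segment length); Kranakis 1986, Thm. 1.15,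
Step 1] [folklore] -/
theorem runs_params (hB : Bnd Q p g y N) (σ : List Bool × List Bool) (v : Vars) :
    Runs (paramsProg Q) (st σ (cParsed p g y) v) (st σ (mkC Q p g y) v)
      ((10900 + 342 * (Q.natDegree + 1)) * (N + 1) ^ 4) := by
  have hp0 := hB.p_pos
  have hl1 : 1 ≤ p.size := Nat.size_pos.2 hp0
  have hU : N + 1 ≤ (N + 1) ^ 3 := succ_le_cube N
  have hU4 : (N + 1) ^ 3 ≤ (N + 1) ^ 4 := Nat.pow_le_pow_right (Nat.succ_pos N) (by norm_num)
  -- Horner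
  have hq : hornerVal p.size 0 (coeffsHL Q) = bmQ Q p := hornerVal_coeffsHL Q p.size
  have hcs : ∀ a ∈ coeffsHL Q, a ≤ bmQ Q p := fun a ha => by
    obtain ⟨i, rfl⟩ := mem_coeffsHL ha
    exact (coeff_le_eval_one Q i).trans (TM2Iter.eval_mono Q hl1)
  have h2 := runs_hornerS hB σ v hB.q_le (coeffsHL Q) (cPar1 p g y) rfl (by rw [show (cPar1 p g y).q = 0 from rfl, hq]) hcs
  rw [show (cPar1 p g y).q = 0 from rfl, hq, length_coeffsHL] at h2
  -- the splitting loop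
  let S : ℕ → Regs (EReg ⊕ O) := fun j => st σ (cStrip Q p g y j) v
  have e1 : ∀ i (w : List Bool), Function.update (S i) (Sum.inr (vv .CS)) w =
      qst σ (Function.update (encSt (cStrip Q p g y i) v) (Sum.inr .CS) w) := fun i w => by simp [S, vv]
  have e0 : cStrip Q p g y 0 = cPar2 Q p g y := by simp [cStrip, cPar2, cPar1, cParsed, zeroC]
  have h4 : Runs (loop (Sum.inr (vv .CS)) stripBodyS.com stripBodyS.com)
      (qst σ (Function.update (encSt (cPar2 Q p g y) v) (Sum.inr .CS) (List.replicate p.size true)))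
      (S p.size) (N * (445 * (N + 1) ^ 3 + 2) + 1) := by
    have hC : ∀ j, S j (Sum.inr (vv .CS)) = [] := fun j => by simp [S, vv]
    have hbody : ∀ j (w : List Bool), j < p.size →
        Runs stripBodyS.com (Function.update (S j) (Sum.inr (vv .CS)) w)
          (Function.update (S (j + 1)) (Sum.inr (vv .CS)) w) (445 * (N + 1) ^ 3) := by
      intro j w _
      rw [e1, e1]
      exact runs_stripBody hB σ v j w
    have := runs_loop_count S (445 * (N + 1) ^ 3) p.size hC hbody (List.replicate p.size true) 0 (by simp)
    simp only [List.length_replicate, Nat.zero_add] at this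
    rw [e1, e0] at this
    refine this.mono ?_
    exact Nat.succ_le_succ (Nat.mul_le_mul_right _ hB.l_le)
  refine ((runs_par1 hB σ v).seq (h2.seq ((runs_par2 hB σ v).seq (h4.seq (runs_par3 hB σ v))))).mono ?_
  have hN3 : N * (445 * (N + 1) ^ 3 + 2) + 1 ≤ 448 * (N + 1) ^ 4 := by
    rw [pow_succ]
    generalize (N + 1) ^ 3 = U at hU ⊢
    nlinarith
  generalize (N + 1) ^ 3 = U at hU hU4 hN3 ⊢
  generalize (N + 1) ^ 4 = W at hU4 hN3 ⊢
  nlinarith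

end Params
/-! ### Parsing, the guard, and the whole machine -/

section Main

variable {Q : Polynomial ℕ} {p g y N : ℕ}

open NS NOp in
/-- The parse: `w = ⟨z, answers⟩`, `answers = ⟨u, s⟩` (raw answer strings, to the answer bank),
`z = ⟨x, r⟩` (coins `r`), `x = ⟨P, ⟨G, Y⟩⟩`, then normalise the three numerals.
[Blum–Micali 1984, §3.3 (the input `p, g, y`); Arora–Barak 2009, §0.1] [folklore] -/
def parseS : NS O :=
  ofList [.unpair (vv .INP) (vv .GT) (vv .QB), .unpair (vv .QB) (Sum.inl .U) (Sum.inl .S), .unpair (vv .GT) (vv .BITS) (vv .R),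
    .unpair (vv .BITS) (cc .P) (vv .CB), .unpair (vv .CB) (cc .G) (cc .Y), .nrm (cc .P), .nrm (cc .G), .nrm (cc .Y)]

open NS NOp in
/-- The guard `p > 2 ∧ 0 < g < p ∧ y < p` into the flag `FQ`. [folklore] -/
def guardS : NS O :=
  (ofList [.const (vv .T1) (encodeNat 3), .cmp (vv .FQ) (cc .P) (vv .T1), .clear (vv .T1)]).seq
    (ite (vv .FQ)
      ((ofList [.const (vv .T1) (encodeNat 1), .cmp (vv .FQ) (cc .G) (vv .T1), .clear (vv .T1)]).seq
        (ite (vv .FQ)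
          ((ofList [.cmp (vv .FQ) (cc .G) (cc .P), .not (vv .FQ)]).seq
            (ite (vv .FQ) (ofList [.cmp (vv .FQ) (cc .Y) (cc .P), .not (vv .FQ)]) nop))
          nop))
      nop)

open NS NOp in
/-- The finish on a normal end: the output numeral from `BEST` to `OUT`, tagged `true` (the
encoding of `Sum.inr`). [folklore] -/
def finS : NS O := ofList [.move (vv .BEST) (Sum.inl .OUT), .push (Sum.inl .OUT) true]

/-- **The Blum–Micali machine**: parse; guard; behind the guard the parameters and the body (else
nothing); finish. [Blum–Micali 1984, §3.3, proof of Theorem 3] [folklore] -/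
noncomputable def bmMachine (Q : Polynomial ℕ) : Com (EReg ⊕ O) :=
  parseS.com ;; ((guardS.com ;; pop (ru (Sum.inr .FQ)) (paramsProg Q ;; bodyProg) skip skip) ;; finS.com)

/-- The size bound as a function of the input length `n`. [folklore] -/
def bmN (Q : Polynomial ℕ) (n : ℕ) : ℕ := 48 * (n + 1) * (Q.eval n + 1) ^ 2 + 6 * n + 2 * Q.eval n + 12

/-- Sizes of products: `x < 2^n · B` gives `|x| ≤ n + |B|`. [folklore] -/
theorem size_le_of_lt_mul {x n B : ℕ} (h : x < 2 ^ n * B) : x.size ≤ n + B.size := by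
  refine Nat.size_le.2 (lt_of_lt_of_le h ?_)
  rw [pow_add]
  exact Nat.mul_le_mul_left _ (Nat.lt_size_self B).le

/-- **The guard yields the size bound.** For a guarded instance with `p < 2^n`, `Bnd Q p g y (bmN Q n)`.
[folklore] -/
theorem bnd_of_guard {n : ℕ} (hG : bmGuard p g y = true) (hpn : p < 2 ^ n) : Bnd Q p g y (bmN Q n) := by
  simp only [bmGuard, Bool.and_eq_true, decide_eq_true_eq] at hG
  obtain ⟨⟨⟨h2, hg0⟩, hgp⟩, hyp⟩ := hG
  have hl : p.size ≤ n := Nat.size_le.2 hpn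
  have hq : bmQ Q p ≤ Q.eval n := TM2Iter.eval_mono Q hl
  have h2qS : 2 * bmQ Q p * bmSeg Q p ≤ p - 1 + 2 * bmQ Q p := by
    unfold bmSeg
    rw [Nat.mul_add, mul_one]
    have := Nat.mul_div_le (p - 1) (2 * bmQ Q p)
    omega
  refine ⟨h2, hg0, hgp, hyp, fun x hx => ?_, ?_, ?_⟩
  · rw [TM2Pass.length_encodeNat_eq_size]
    have hx' : x < 2 ^ n * (5 + 2 * Q.eval n) := by
      have : x < 5 * p + 2 * bmQ Q p := by omega
      nlinarith
    refine (size_le_of_lt_mul hx').trans ?_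
    have := Nat.size_le.2 (Nat.lt_two_pow_self (n := 5 + 2 * Q.eval n))
    have hs : (5 + 2 * Q.eval n).size ≤ 5 + 2 * Q.eval n := Nat.size_le.2 Nat.lt_two_pow_self
    unfold bmN; nlinarith
  · unfold bmN
    have h1 : (p.size + 1) * (bmQ Q p + 1) ^ 2 ≤ (n + 1) * (Q.eval n + 1) ^ 2 :=
      Nat.mul_le_mul (by omega) (Nat.pow_le_pow_left (by omega) 2)
    nlinarith
  · rw [TM2Pass.length_encodeNat_eq_size]; unfold bmN; nlinarith

/-- The all-empty register file is the clean state with empty user banks; the input register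
loaded with `w` is an update of it. [folklore] -/
theorem init_eq (w : List Bool) :
    Regs.init (Sum.inr (vv .INP)) w =
      base (ust (QReg.file [] [] [] [] []) (Function.update (encSt zeroC (initVars [])) (Sum.inr .INP) w)) := by
  funext i
  simp only [Regs.init]
  rcases i with ((a | m) | eo) | (q | (c | v))
  · cases a <;> simp [vv]
  · cases m <;> simp [vv]
  · cases eo <;> simp [vv]
  · cases q <;> simp [vv]
  · cases c <;> simp [vv, zeroC]
  · cases v <;> simp [vv, initVars]

/-- **Effect of the parse** on an arbitrary input `w`: the raw answer strings go to the answer bank,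
the coins to `R`, the numerals of `p, g, y` to the constants bank. [folklore] -/
theorem runs_parseS (w : List Bool) :
    Runs parseS.com (Regs.init (Sum.inr (vv .INP)) w)
      (qst (boolUnpair (boolUnpair w).2)
        (encSt (cParsed (bitsToNat (boolUnpair (boolUnpair (boolUnpair w).1).1).1)
          (bitsToNat (boolUnpair (boolUnpair (boolUnpair (boolUnpair w).1).1).2).1)
          (bitsToNat (boolUnpair (boolUnpair (boolUnpair (boolUnpair w).1).1).2).2))
          (initVars (boolUnpair (boolUnpair w).1).2)))
      (170 * (w.length + 1) ^ 3) := by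
  rw [init_eq]
  have h0 := length_boolUnpair_parts_le w
  have h1 := length_boolUnpair_parts_le (boolUnpair w).1
  have h2 := length_boolUnpair_parts_le (boolUnpair w).2
  have h3 := length_boolUnpair_parts_le (boolUnpair (boolUnpair w).1).1
  have h4 := length_boolUnpair_parts_le (boolUnpair (boolUnpair (boolUnpair w).1).1).2
  refine NS.runs_of_eq (N := w.length) parseS _ ?_ ?_ ?_
  · simp [parseS, vv, cc, initVars, zeroC]
    omega
  · simp [parseS, vv, cc, initVars, cParsed, zeroC, norm_eq_encodeNat]
    congr 1; funext r; rcases r with r | r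
    · cases r <;> simp
    · cases r <;> simp
  · simp [parseS]

/-- **Effect of the guard**: the flag `FQ` receives `bmGuard p g y`. [folklore] -/
theorem runs_guardS {n : ℕ} (σ : List Bool × List Bool) (r : List Bool) (hp : (encodeNat p).length ≤ n)
    (hg : (encodeNat g).length ≤ n) (hy : (encodeNat y).length ≤ n) :
    Runs guardS.com (st σ (cParsed p g y) (initVars r))
      (qst σ (Function.update (encSt (cParsed p g y) (initVars r)) (Sum.inr .FQ) (flag (bmGuard p g y)))) (300 * (n + 3) ^ 3) := by
  have h3 : (encodeNat 3).length ≤ n + 2 := by rw [show (encodeNat 3).length = 2 from rfl]; omega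
  have h1 : (encodeNat 1).length ≤ n + 2 := by rw [show (encodeNat 1).length = 1 from rfl]; omega
  by_cases hp2 : 3 ≤ p
  · by_cases hg1 : 1 ≤ g
    · by_cases hgp : p ≤ g
      · have hG : bmGuard p g y = false := by simp [bmGuard]; omega
        refine NS.runs_of_eq (N := n + 2) guardS _ ?_ ?_ ?_
        · simp [guardS, vv, cc, cParsed, zeroC, initVars, hp2, hg1, hgp]; omega
        · simp [guardS, vv, cc, cParsed, zeroC, initVars, hp2, hg1, hgp, hG]
          congr 1; funext r; rcases r with r | r
          · cases r <;> simp
          · cases r <;> simp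
        · simp [guardS]
      · by_cases hyp : p ≤ y
        · have hG : bmGuard p g y = false := by simp [bmGuard]; omega
          refine NS.runs_of_eq (N := n + 2) guardS _ ?_ ?_ ?_
          · simp [guardS, vv, cc, cParsed, zeroC, initVars, hp2, hg1, hgp, hyp]; omega
          · simp [guardS, vv, cc, cParsed, zeroC, initVars, hp2, hg1, hgp, hyp, hG]
            congr 1; funext r; rcases r with r | r
            · cases r <;> simp
            · cases r <;> simp
          · simp [guardS]
        · have hG : bmGuard p g y = true := by simp [bmGuard]; omega
          refine NS.runs_of_eq (N := n + 2) guardS _ ?_ ?_ ?_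
          · simp [guardS, vv, cc, cParsed, zeroC, initVars, hp2, hg1, hgp, hyp]; omega
          · simp [guardS, vv, cc, cParsed, zeroC, initVars, hp2, hg1, hgp, hyp, hG]
            congr 1; funext r; rcases r with r | r
            · cases r <;> simp
            · cases r <;> simp
          · simp [guardS]
    · have hG : bmGuard p g y = false := by simp [bmGuard]; omega
      refine NS.runs_of_eq (N := n + 2) guardS _ ?_ ?_ ?_
      · simp [guardS, vv, cc, cParsed, zeroC, initVars, hp2, hg1]; omega
      · simp [guardS, vv, cc, cParsed, zeroC, initVars, hp2, hg1, hG]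
        congr 1; funext r; rcases r with r | r
        · cases r <;> simp
        · cases r <;> simp
      · simp [guardS]
  · have hG : bmGuard p g y = false := by simp [bmGuard]; omega
    refine NS.runs_of_eq (N := n + 2) guardS _ ?_ ?_ ?_
    · simp [guardS, vv, cc, cParsed, zeroC, initVars, hp2]; omega
    · simp [guardS, vv, cc, cParsed, zeroC, initVars, hp2, hG]
      congr 1; funext r; rcases r with r | r
      · cases r <;> simp
      · cases r <;> simp
    · simp [guardS]

/-- **The guarded main part implements `bmMainC`**: the guard, then — behind it — the
parameters and the body, else nothing; afterwards `BEST` holds the output string `b`, of length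
at most the input's. [Blum–Micali 1984, §3.3, proof of Theorem 3] [cite: BlumMicali1984, Theorem 3 (proof)] -/
theorem impl_main (Q : Polynomial ℕ) {n p g y : ℕ} (r : List Bool) {σ : List Bool × List Bool}
    (hσ : σ.2.length ≤ n) (hpn : p < 2 ^ n) (hp : (encodeNat p).length ≤ n) (hg : (encodeNat g).length ≤ n)
    (hy : (encodeNat y).length ≤ n) :
    Impl (guardS.com ;; pop (ru (Sum.inr .FQ)) (paramsProg Q ;; bodyProg) skip skip) (bmMainC Q p g y r) σ
      (encSt (cParsed p g y) (initVars r))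
      (fun b T' => T' (Sum.inr .BEST) = b ∧ b.length ≤ n)
      ((40300 + 342 * (Q.natDegree + 1)) * (bmN Q n + 1) ^ 6 + 300 * (n + 3) ^ 3 + 2) := by
  have hguard := runs_guardS σ r hp hg hy (p := p) (g := g) (y := y)
  have hin : Impl (pop (ru (Sum.inr .FQ)) (paramsProg Q ;; bodyProg) skip skip) (bmMainC Q p g y r) σ
      (Function.update (encSt (cParsed p g y) (initVars r)) (Sum.inr .FQ) (flag (bmGuard p g y)))
      (fun b T' => T' (Sum.inr .BEST) = b ∧ b.length ≤ n)
      ((40300 + 342 * (Q.natDegree + 1)) * (bmN Q n + 1) ^ 6 + 2) := by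
    by_cases hG : bmGuard p g y = true
    · -- behind the guard
      have hB : Bnd Q p g y (bmN Q n) := bnd_of_guard hG hpn
      have hσN : σ.2.length ≤ bmN Q n := hσ.trans (by unfold bmN; omega)
      have hupd : Function.update (Function.update (encSt (cParsed p g y) (initVars r)) (Sum.inr BV.FQ)
          (flag (bmGuard p g y))) (Sum.inr BV.FQ) [] = encSt (cParsed p g y) (initVars r) := by
        rw [Function.update_idem]; exact Function.update_eq_self_iff.2 rfl
      refine Impl.of_pop_true ?_ ?_
      · simp [hG]
      rw [hupd, bmMainC, if_pos hG]
      have h := impl_runs_seq (runs_params hB σ (initVars r)) (impl_body hB hσN r)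
      refine (h.weaken fun b T' hT' => ?_).mono ?_
      · obtain ⟨v, rfl, rfl, hv⟩ := hT'
        exact ⟨by simp, (Brick.length_encodeNat_mono hv.le).trans hp⟩
      · have hW : (bmN Q n + 1) ^ 4 ≤ (bmN Q n + 1) ^ 6 := Nat.pow_le_pow_right (Nat.succ_pos _) (by norm_num)
        generalize (bmN Q n + 1) ^ 4 = U at hW ⊢
        generalize (bmN Q n + 1) ^ 6 = W at hW ⊢
        nlinarith
    · -- the guard fails: output `[]` at once
      have hG' : bmGuard p g y = false := by simpa using hG
      refine Impl.of_pop_nil ?_ ?_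
      · simp [hG']
      rw [bmMainC]
      simp only [hG', Bool.false_eq_true, if_false]
      exact (impl_of_runs (Runs.skip _) ⟨by simp [initVars], by simp⟩).mono (Nat.zero_le _)
  exact (impl_runs_seq hguard hin).mono (le_of_eq (by ring))

/-- **Effect of the finish**: `OUT := true :: b` for the output string `b` held in `BEST`. [folklore] -/
theorem runs_finS {n : ℕ} (σ : List Bool × List Bool) (T : Regs (BC ⊕ BV)) {b : List Bool}
    (hb : T (Sum.inr .BEST) = b) (hn : b.length ≤ n) :
    Runs finS.com (qst σ T)
      (base (ust (QReg.file σ.1 σ.2 [] [] (true :: b)) (Function.update T (Sum.inr .BEST) []))) (9 * (n + 1) ^ 3) := by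
  refine NS.runs_of_eq (N := n) finS _ ?_ ?_ ?_
  · simp [finS, vv, hb, hn]
  · simp [finS, vv, hb]
  · simp [finS]

/-- The parse of the machine input, as `bmComp` parses it. [folklore] -/
theorem bmComp_eq (Q : Polynomial ℕ) (z : List Bool) :
    bmComp Q z = bmMainC Q (bitsToNat (boolUnpair (boolUnpair z).1).1)
      (bitsToNat (boolUnpair (boolUnpair (boolUnpair z).1).2).1)
      (bitsToNat (boolUnpair (boolUnpair (boolUnpair z).1).2).2) (boolUnpair z).2 := rfl

/-- **The string function of the machine**: on input `w = ⟨z, ⟨u, s⟩⟩`, the tagged result of the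
raw replay of `bmComp Q z` against the raw answers `(u, s)` — `false :: q` at an unanswered query
`q`, `true :: b` for an output `b`. [folklore] -/
noncomputable def bmF (Q : Polynomial ℕ) (w : List Bool) : List Bool :=
  Sum.elim (fun q => false :: q) (fun bσ => true :: bσ.1)
    (OracleComp.feedRaw (bmComp Q (boolUnpair w).1) (boolUnpair (boolUnpair w).2))

/-- The running-time polynomial of the machine. [folklore] -/
noncomputable def bmTime (Q : Polynomial ℕ) : Polynomial ℕ :=
  Polynomial.C (41000 + 342 * (Q.natDegree + 1)) *
    (48 * (Polynomial.X + 1) * (Q + 1) ^ 2 + 6 * Polynomial.X + 2 * Q + 13) ^ 6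

/-- Evaluation of the running-time polynomial. [folklore] -/
theorem bmTime_eval (Q : Polynomial ℕ) (n : ℕ) :
    (bmTime Q).eval n = (41000 + 342 * (Q.natDegree + 1)) * (bmN Q n + 1) ^ 6 := by
  simp [bmTime, bmN]

/-- A parsed number is below `2^n`, `n` the input length. [folklore] -/
theorem bitsToNat_lt_two_pow_of_le {v : List Bool} {n : ℕ} (h : v.length ≤ n) : bitsToNat v < 2 ^ n :=
  lt_of_lt_of_le (bitsToNat_lt v) (Nat.pow_le_pow_right two_pos h)

/-- Assembling parse, main part and finish: the whole program runs (or halts at a query) to a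
register file whose `OUT` holds the tagged result of the replay. [folklore] -/
theorem runs_or_halts_of_impl {P M : Com (EReg ⊕ O)} {R₀ : Regs (EReg ⊕ O)} {c : OracleComp (List Bool)}
    {σ : List Bool × List Bool} {T : Regs (BC ⊕ BV)} {n B₁ B₂ : ℕ} (hparse : Runs P R₀ (qst σ T) B₁)
    (hmain : Impl M c σ T (fun b T' => T' (Sum.inr .BEST) = b ∧ b.length ≤ n) B₂) :
    ∃ R', (Runs (P ;; (M ;; finS.com)) R₀ R' (B₁ + (B₂ + 9 * (n + 1) ^ 3)) ∨
        Halts (P ;; (M ;; finS.com)) R₀ R' (B₁ + (B₂ + 9 * (n + 1) ^ 3))) ∧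
      R' (Sum.inr (Sum.inl .OUT)) =
        Sum.elim (fun q => false :: q) (fun bσ => true :: bσ.1) (OracleComp.feedRaw c σ) := by
  unfold Impl at hmain
  rcases hfeed : OracleComp.feedRaw c σ with q | ⟨b, σ'⟩
  · rw [hfeed] at hmain
    obtain ⟨R', hH, hout⟩ := hmain
    exact ⟨R', Or.inr ((hparse.seq_halts (hH.seq finS.com)).mono (by omega)), by rw [hout]; rfl⟩
  · rw [hfeed] at hmain
    obtain ⟨T', hR, hb, hbn⟩ := hmain
    exact ⟨_, Or.inl (hparse.seq (hR.seq (runs_finS σ' T' hb hbn))), by simp⟩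

/-- **The machine computes `bmF Q` within `bmTime Q` steps** on every input (running or halting
at a query). [Blum–Micali 1984, §3.3, proof of Theorem 3] [cite: BlumMicali1984, Theorem 3 (proof)] -/
theorem bmMachine_spec (Q : Polynomial ℕ) (w : List Bool) :
    ∃ R', (Runs (bmMachine Q) (Regs.init (Sum.inr (vv .INP)) w) R' ((bmTime Q).eval w.length) ∨
      Halts (bmMachine Q) (Regs.init (Sum.inr (vv .INP)) w) R' ((bmTime Q).eval w.length)) ∧
      R' (Sum.inr (Sum.inl .OUT)) = bmF Q w := by
  have h0 := length_boolUnpair_parts_le w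
  have h1 := length_boolUnpair_parts_le (boolUnpair w).1
  have h2 := length_boolUnpair_parts_le (boolUnpair w).2
  have h3 := length_boolUnpair_parts_le (boolUnpair (boolUnpair w).1).1
  have h4 := length_boolUnpair_parts_le (boolUnpair (boolUnpair (boolUnpair w).1).1).2
  have hP'n : (boolUnpair (boolUnpair (boolUnpair w).1).1).1.length ≤ w.length := by omega
  have hG'n : (boolUnpair (boolUnpair (boolUnpair (boolUnpair w).1).1).2).1.length ≤ w.length := by omega
  have hY'n : (boolUnpair (boolUnpair (boolUnpair (boolUnpair w).1).1).2).2.length ≤ w.length := by omega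
  have hσn : (boolUnpair (boolUnpair w).2).2.length ≤ w.length := by omega
  have hmain := impl_main Q (boolUnpair (boolUnpair w).1).2 hσn (bitsToNat_lt_two_pow_of_le hP'n)
    ((Brick.length_encodeNat_bitsToNat_le _).trans hP'n) ((Brick.length_encodeNat_bitsToNat_le _).trans hG'n)
    ((Brick.length_encodeNat_bitsToNat_le _).trans hY'n)
  obtain ⟨R', hR, hout⟩ := runs_or_halts_of_impl (runs_parseS w) hmain
  have hbud : 170 * (w.length + 1) ^ 3 + (((40300 + 342 * (Q.natDegree + 1)) * (bmN Q w.length + 1) ^ 6 +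
      300 * (w.length + 3) ^ 3 + 2) + 9 * (w.length + 1) ^ 3) ≤ (bmTime Q).eval w.length := by
    rw [bmTime_eval]
    generalize w.length = n
    have hnN : n + 3 ≤ bmN Q n + 1 := by unfold bmN; omega
    have h3 : (n + 3) ^ 3 ≤ (bmN Q n + 1) ^ 6 :=
      (Nat.pow_le_pow_left hnN 3).trans (Nat.pow_le_pow_right (Nat.succ_pos _) (by norm_num))
    have h1 : (n + 1) ^ 3 ≤ (n + 3) ^ 3 := Nat.pow_le_pow_left (by omega) 3
    have h6 : 1 ≤ (bmN Q n + 1) ^ 6 := Nat.one_le_pow _ _ (Nat.succ_pos _)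
    generalize (bmN Q n + 1) ^ 6 = W at h3 h6 ⊢
    generalize (n + 3) ^ 3 = V at h3 h1 ⊢
    generalize (n + 1) ^ 3 = U at h1 ⊢
    nlinarith
  refine ⟨R', ?_, ?_⟩
  · rcases hR with hR | hR
    · exact Or.inl (hR.mono hbud)
    · exact Or.inr (hR.mono hbud)
  · rw [hout, bmF, bmComp_eq]

/-- **The step function of the reduction is an `FP` string function** (through the pairing of its
two arguments). [Blum–Micali 1984, §3.3, proof of Theorem 3 ("the following probabilistic poly(|p|)
time algorithm")] [cite: BlumMicali1984, Theorem 3 (proof)] -/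
theorem bmF_mem_FP (Q : Polynomial ℕ) : bmF Q ∈ FP :=
  Com.mem_FP (bmMachine Q) (Sum.inr (vv .INP)) (Sum.inr (Sum.inl .OUT)) (bmTime Q) (bmF Q) (bmMachine_spec Q)

/-- `bmF Q` on a well-formed machine input is the encoded step of `bmOracleAlg Q`. [folklore] -/
theorem bmF_boolPair (Q : Polynomial ℕ) (x : List Bool) (as : List (List Bool)) :
    bmF Q (boolPair x ((encodingList Bool).listBool.encode as)) =
      ((encodingList Bool).sumBool (encodingList Bool)).encode ((bmOracleAlg Q).step x as) := by
  rw [bmF, boolUnpair_boolPair, OracleComp.boolUnpair_listBool_encode]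
  change _ = ((encodingList Bool).sumBool (encodingList Bool)).encode (OracleComp.toStep (bmComp Q x) as)
  rw [OracleComp.toStep_eq_feedRaw]
  cases OracleComp.feedRaw (bmComp Q x) (unaryEncodeNat as.length, List.foldr (fun a acc => boolPair a acc) [] as) with
  | inl q => rfl
  | inr bσ => rfl

end Main

end BMMachine

open _root_.Computability Complexity in
/-- **Discharge of `bmOracleAlg_isPolyTime`.** For every polynomial `Q`, the transcript step
function of the Blum–Micali reduction `bmOracleAlg Q` is polynomial-time computable in
Mathlib's `TM2` model: the stack machine `BMMachine.bmMachine Q` computes its tagged string form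
within `BMMachine.bmTime Q` steps (`BMMachine.bmMachine_spec`), stack programs with polynomial
cost are `FP` (`Com.mem_FP`, `BMMachine.bmF_mem_FP`), and the string function is re-indexed along
the input pairing (`PolyTimeComputable.of_encode`, `BMMachine.bmF_boolPair`).
[Blum–Micali 1984, §3.3, proof of Theorem 3] [cite: BlumMicali1984, Theorem 3 (proof)] -/
theorem bmOracleAlg_isPolyTime_holds : bmOracleAlg_isPolyTime := fun Q =>
  PolyTimeComputable.of_encode (BMMachine.bmF_mem_FP Q)
    (fun a : List Bool × List (List Bool) => boolPair a.1 ((encodingList Bool).listBool.encode a.2))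
    (fun _ => rfl) fun a => BMMachine.bmF_boolPair Q a.1 a.2

end Literature.Computability.Cryptography
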